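import Mathlib
import HarnessLib
import HarnessLib.Audit
import Summits.FinalStateConjecture.Statement
import Literature.Geometry.Lorentzian.Stationary
import Literature.Geometry.Lorentzian.KerrData
import Literature.Geometry.Lorentzian.Geodesic
import Literature.Geometry.Lorentzian.Einstein
import HarnessLib.Audit.Status.Attr

/-!
Route: BeltLiouville

DORMANT since 2026-08-20T20:56:47Z (reconciler: no traction for 5 d (last activity statement-checked at 2026-08-15T20:39:20Z); parked, not closed — `ledger route dormant route-FinalStateConjecture-BeltLiouville --off` to reactivate) — unstaffed, not closed; items shared with open routes are served there. `ledger route dormant <id> --off` reactivates.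

# Route BeltLiouville — smooth no-hair as a Liouville theorem on the ergoregion belt, killed by a
zero-frequency virial

It suffices to show X = SMOOTH HAWKING RIGIDITY FOR THE BELT CLASS (the Hawking-rigidity step of the
Alexakis–Ionescu–Klainerman
conjecture, arXiv:1501.01587 §4, in extension form): for every smooth (not analytic) vacuum
stationary AF black hole 𝓑 with simply connected d.o.c. (the topological-censorship clause of
ChruscielWald1994Topology Thm 2.3, made explicit at the 2026-08-15 route repair) and connected
horizon carrying a Killing collar K (K Killing on an open U ⊇ horizon, [T,K] = 0, non-degenerate:
∇_K K = κK, κ ≠ 0), whose d.o.c. is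
compact modulo T away from the horizon and infinity, and which has NO zero-energy (T-perpendicular)
null geodesic trapped in a T-compact
subset of the d.o.c., the collar field K extends to a T-commuting Killing field on the whole d.o.c.
(⇒ axisymmetry). X is reached through
the card fill-the-belt-zero-frequency-liouville: X ⇐ BeltKillingLiouville (K1: a T-commuting field
Killing off a T-compact belt agrees near
infinity with a Killing field of the d.o.c. — rigidity as a LIOUVILLE theorem for compactly
supported zero-frequency Killing defects)
+ BeltReduction (K3: close Ẑ from both ends — collar and the analytic T-timelike region through the
poles — so the defect IS belt-compact).
The frame FinalStateFromRigidity (X → summit: censorship + settling into the belt class + smooth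
Carter–Robinson) docks the stationary-limit cards.
Lean: `∀ (𝓑 : StationaryAFBlackHole.{0}) [𝓑.metric.HasLeviCivita],
𝓑.metric.toPseudoRiemannianMetric.IsRicciFlat → SimplyConnectedSpace 𝓑.doc → ∀ (U : Set 𝓑.carrier)
(K : Π x : 𝓑.carrier, TangentSpace (𝓡 4) x) (κ : ℝ), IsOpen U → 𝓑.horizon ⊆ U → IsConnected
𝓑.horizon → ContMDiffOn (𝓡 4) ((𝓡 4).prod 𝓘(ℝ, E4)) ∞ (fun x ↦ (Bundle.TotalSpace.mk' E4 x (K x) :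
TangentBundle (𝓡 4) 𝓑.carrier)) U → (∀ x ∈ U, ∀ v w : TangentSpace (𝓡 4) x, 𝓑.metric.val x
(𝓑.metric.leviCivita K x v) w + 𝓑.metric.val x v (𝓑.metric.leviCivita K x w) = 0) → (∀ x ∈ U,
VectorField.mlieBracket (𝓡 4) 𝓑.killing K x = 0) → (∀ p ∈ 𝓑.horizon, K p ≠ 0) → (∀ γ : ℝ →
𝓑.carrier, IsMIntegralCurve γ K → γ 0 ∈ 𝓑.horizon → ∀ t, γ t ∈ 𝓑.horizon) → κ ≠ 0 → (∀ p ∈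
𝓑.horizon, 𝓑.metric.leviCivita K p (K p) = κ • K p) → (∃ (U₁ : Set 𝓑.carrier) (R' : ℝ) (S : Set
𝓑.carrier), IsOpen U₁ ∧ 𝓑.horizon ⊆ U₁ ∧ closure U₁ ⊆ U ∧ 𝓑.e.R + 1 ≤ R' ∧ IsCompact S ∧ S ⊆ 𝓑.doc ∧
Disjoint (stationaryOrbit 𝓑.killing S) (stationaryOrbit 𝓑.killing (𝓑.embed '' 𝓑.e.far (R' + 1))) ∧ ∀
x ∈ 𝓑.doc, x ∉ U₁ → x ∉ (stationaryOrbit 𝓑.killing (𝓑.embed '' 𝓑.e.far R')) → x ∈ stationaryOrbit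
𝓑.killing S) → (∀ S : Set 𝓑.carrier, IsCompact S → S ⊆ 𝓑.doc → (∀ (γ : ℝ → 𝓑.carrier) (s : Set ℝ),
IsMaximalGeodesicOn 𝓑.metric.toPseudoRiemannianMetric.leviCivita γ s → s.Nonempty → (∀ t ∈ s,
𝓑.metric.val (γ t) (velocity (𝓡 4) γ t) (velocity (𝓡 4) γ t) = 0 ∧ velocity (𝓡 4) γ t ≠ 0 ∧
𝓑.metric.val (γ t) (velocity (𝓡 4) γ t) (𝓑.killing (γ t)) = 0) → ∃ t ∈ s, γ t ∉ stationaryOrbit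
𝓑.killing S)) → ∃ K' : Π x : 𝓑.carrier, TangentSpace (𝓡 4) x, ContMDiffOn (𝓡 4) ((𝓡 4).prod 𝓘(ℝ,
E4)) ∞ (fun x ↦ (Bundle.TotalSpace.mk' E4 x (K' x) : TangentBundle (𝓡 4) 𝓑.carrier)) 𝓑.doc ∧ (∀ x ∈
𝓑.doc, ∀ v w : TangentSpace (𝓡 4) x, 𝓑.metric.val x (𝓑.metric.leviCivita K' x v) w + 𝓑.metric.val x
v (𝓑.metric.leviCivita K' x w) = 0) ∧ (∀ x ∈ 𝓑.doc, VectorField.mlieBracket (𝓡 4) 𝓑.killing K' x =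
0) ∧ ∃ U' : Set 𝓑.carrier, IsOpen U' ∧ 𝓑.horizon ⊆ U' ∧ ∀ x ∈ U' ∩ 𝓑.doc, K' x = K x`

## Assembly
Pure logic (sorry-free in Sketch.lean, `assembly_holds` and `closes`): BeltReduction applied
hole-by-hole to the instance of
BeltKillingLiouville gives SmoothHawkingRigidity (TargetOfCruxes); FinalStateFromRigidity turns it
into the summit statement. The deciding
theorem `closes` takes all seven items as hypotheses (file order) and uses Assembly on the two
cruxes and the frame. (2026-08-15 repair: the clause `SimplyConnectedSpace 𝓑.doc` is threaded
through
SmoothHawkingRigidity, BeltKillingLiouville and BeltReduction right after the vacuum hypothesis;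
TargetOfCruxes, Assembly and `closes` are
by decl name and unchanged — their proofs re-thread one hypothesis.)

Rationale: WHY THIS LINE. Every stationary-limit strategy for the summit dies on the no-hair step without
analyticity (barrier IonescuKlainermanNonExtension); what
is KNOWN corners it: the Hawking field is Killing on a full collar of a non-degenerate horizon
(arXiv:0902.1173; arXiv:1903.09135 Thm 1.17)
and extension through {T timelike} is free (arXiv:1501.01587 §3.7), so the obstruction is an EXACT,
T-stationary, compactly-supported-mod-T
solution w = 𝓛_Ẑ g of linearised vacuum on the ergoregion belt, and rigidity becomes global
injectivity (a Liouville theorem), tolerant of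
derivative loss and blind to the locality that makes Ionescu–Klainerman hair possible
(IonescuKlainerman2012 Thm 1.3). The engine imported
from spectral/scattering theory is the positive-commutator (Morawetz 1954–58 mixed-type uniqueness;
Froese–Herbst virial) at frequency
zero with an escape function built from zero-energy non-trapping — exactly the hypothesis of the AIK
conjecture, which Kerr satisfies for all
|a| < M (E = 0 ⇒ R(r) = a²L² − Δ(L²+Q) strictly decreasing); on Kerr the ingoing-coordinate
stationary operator ∂_rΔ∂_r + 2a∂_r∂_φ̃ + Δ_S²
carries its whole hyperbolicity in an azimuthal total derivative (card identity, f = Δ^½). Prior art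
continues K across hypersurfaces
(T-conditional Carleman: AlexakisIonescuKlainerman2009; card zero-energy-optics-kerr-or-bomb) or
assumes analyticity (ChruscielCosta2008);
Moschidis (arXiv:1608.02035) has the vector-field Carleman estimate OUTSIDE the ergoregion only.
Negatives index: empty.

RANKED CRUXES. #0 SmoothHawkingRigidity (target) — X as in § Thesis: vacuum 𝓑 :
StationaryAFBlackHole with simply connected d.o.c. (`SimplyConnectedSpace 𝓑.doc`, the
ChruscielWald1994Topology Thm 2.3 clause; 2026-08-15 repair), U open ⊇ horizon (connected), K smooth
and Killing on U, [T,K] = 0 on U, K ≠ 0 and tangent on the horizon, ∇_K K = κK with κ ≠ 0, d.o.c.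
covered by U₁ ⋐ U, the T-orbit of a compact S ⊆ doc and the T-orbit of the region beyond radius R'
(orbit S disjoint from the region beyond R'+1), and no maximal null geodesic with g(γ',T) = 0
contained in the T-orbit of a compact subset of doc ⟹ ∃ K' smooth and Killing on doc, [T,K'] = 0 on
doc, K' = K on U' ∩ doc for some open U' ⊇ horizon. (why it might fail: It is the Hawking step of
the AIK conjecture (arXiv:1501.01587 §4), open; a smooth non-Kerr stationary vacuum hole with hair
confined to a zero-energy-non-trapping belt refutes it, and IK's local hair (JAMS 2013 Thm 1.3)
shows the equations alone do not forbid hair; the hypothesis structure still omits I⁺-regularity and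
horizon topology — only π₁(doc) = 0 is now assumed.) [arXiv:1501.01587,
AlexakisIonescuKlainerman2009, arXiv:1903.09135, IonescuKlainerman2012, ChruscielWald1994Topology]
#2 BeltKillingLiouville (crux) — [card K1, vector-field form; 2026-08-15 repair: + π₁(doc) = 0] For
a vacuum 𝓑 with simply connected d.o.c., a compact S ⊆ doc and R' ≥ e.R+1 with orbit_T(S) disjoint
from orbit_T(embed(far R')), such that no maximal zero-energy (g(γ',T)=0) null geodesic lies inside
orbit_T(S): every Z smooth on doc with [T,Z] = 0 on doc and Killing on doc ∖ orbit_T(S) admits Z'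
smooth and Killing on doc with Z' = Z on orbit_T(embed(far R')). Equivalently: the exact,
T-stationary, belt-supported linearised vacuum solution w = 𝓛_Z g is 𝓛_X g with X vanishing near
infinity. (Agreement is asked ONLY near infinity: off the belt it is false already on Kerr, see §
Cheapest falsifier.) [difficulty: XL] (why it might fail: With π₁(doc) = 0 the flat holonomy witness
ℝ × X_α of the retriage pass is gone (flat Killing germs extend by Nomizu on simply connected
analytic regions), but genuine smooth belt hair is not excluded by any theorem: the engine is a
zero-frequency positive commutator for the IK system (wave for 𝓛_Z R, transport for π = 𝓛_Z g), the
transport half has no Morawetz positivity, and tensorial multipliers on the Lorentzian belt orbit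
space may not be coercive far from Kerr.) [arXiv:1108.3575, arXiv:1501.01587, arXiv:1608.02035,
AlexakisIonescuKlainerman2009, ChruscielWald1994Topology, Nomizu1960]
#3 BeltReduction (crux) — [card K3, per hole] Under the hypotheses of SmoothHawkingRigidity for (𝓑,
U, K, κ), now including `SimplyConnectedSpace 𝓑.doc`, the belt Liouville property of THIS hole
(verbatim the body of BeltKillingLiouville at 𝓑, its vacuum and simple-connectivity hypotheses
discharged by those of X) implies the conclusion of SmoothHawkingRigidity. Intended proof: poles
exist (hairy ball on S² sections, T ∥ K there) and the collar meets A = {T timelike} near them; A is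
analytic (Müller zum Hagen) so K continues (Nomizu) through the pole component of A out to M_ext;
the complement in doc of (U₁ ∪ that component) is a T-compact belt by the doc-compactness
hypothesis; a T-invariant cutoff gives Z, and BeltKillingLiouville plus unique continuation of
Killing fields on the connected set (U ∩ doc) ∪ A returns K' = K near the horizon. [deps:
BeltKillingLiouville] [difficulty: L] (why it might fail: The collar must MEET {T timelike} at the
poles and that component must contain M_ext; Nomizu continuation through the (Müller zum
Hagen-analytic) T-timelike region picks up monodromy if that region is not simply connected (π₁(doc)
= 0 is now available but does not control π₁ of the pole component of A ∩ doc); the T-invariant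
cutoff needs a margin the doc-compactness clause may not give.) [arXiv:0902.1173, arXiv:1903.09135,
ChruscielCosta2008, ChruscielCostaHeusler2012, Nomizu1960, ChruscielWald1994Topology,
arXiv:1501.01587]
#4 FinalStateFromRigidity (crux) — [frame #1: X → Statement] SmoothHawkingRigidity implies the final
state conjecture: weak cosmic censorship + settling of Christodoulou-generic MGHDs to finitely many
receding stationary vacuum black-hole exteriors in the belt class (non-degenerate Killing collar by
arXiv:1903.09135 Thm 1.17, doc compact mod T, zero-energy non-trapping — or else a
Friedman/superradiant-bomb instability makes the limit non-generic) + smooth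
Carter–Robinson–Chruściel–Costa (axisymmetric ⇒ Kerr) + sub-extremality and exhaustive charts. This
is the docking statement for the stationary-limit cards (lasalle-bondi-lyapunov-liouville,
dissipation-budget-quiet-window-capture, two-boundary-squeeze-observability-lojasiewicz,
zero-energy-optics-kerr-or-bomb K4); it is expected to be split/superseded by their routes, not
attacked head-on here. [deps: SmoothHawkingRigidity] [difficulty: open-problem] (why it might fail:
Contains weak cosmic censorship and large-data asymptotic stationarity; generic limits must be
non-degenerate with no T-trapped zero-energy null geodesic, but the only removal mechanism (Friedman
instability, arXiv:1608.02035 Thm 1.1) is proved solely when the ergoregion misses the horizon.)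
[DafermosLuk2017, ChruscielCosta2008, arXiv:1608.02035, Klainerman2025, arXiv:1903.09135]
#9 KerrStationaryScalarLiouville (support) — [card P1, the model identity] On sub-extremal Kerr
(ingoing Kerr–Schild exterior chart) a smooth solution of □_g ψ = 0 with ∂_{t*}ψ = 0 that vanishes
for r ≤ r₊+δ and for r ≥ R vanishes identically. Proof intended: the card's multiplier identity f
ψ_r (Pψ) sinθ = div(…) + ½(fΔ′−f′Δ)ψ_r² sinθ + ½f′|∇̸ψ|² sinθ with f = Δ^½ (bulk = ¼Δ′Δ^(−½)(Δψ_r² +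
|∇̸ψ|²) ≥ 0) for P = ∂_rΔ∂_r + 2a∂_r∂_φ̃ + Δ_S², the ergoregion term being the azimuthal total
derivative ∂_φ̃(a f ψ_r² sinθ); alternatively Holmgren–John across the non-characteristic spheres r
= const (analytic coefficients). [difficulty: L] [arXiv:0811.0354, Wald1984GR,
DafermosRodnianskiShlapentokhrothman2014]
#9 TargetOfCruxes (support) — [pure logic, PROVED in Sketch.lean as targetOfCruxes_holds]
BeltKillingLiouville → BeltReduction → SmoothHawkingRigidity (by decl name; the decls precede it in
the route file): fix the hole and the collar data, feed BeltReduction the instance of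
BeltKillingLiouville at that hole. [difficulty: provable-now] [arXiv:1501.01587]

TWO-LAYER PLAN. Foreseen glued splits (none filed now): BeltKillingLiouville ⇐
ZeroFrequencyEscapeFunction (non-trapping of zero-energy null
bicharacteristics over the compact reduced belt ⇒ a T-invariant escape function) →
PositiveCommutatorIK (integrated virial identity for the
Ionescu–Klainerman (π, W) system on T-invariant belt-supported fields, lossy allowed) →
BeltKillingLiouville; BeltReduction ⇐ PolesAndContact
(S² sections, T ∥ K at a pole, collar meets {T timelike}) → AnalyticContinuationThroughA (Müller zum
Hagen + Nomizu, pole component ∋ M_ext)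
→ BeltReduction; FinalStateFromRigidity ⇐ SettlingToStationaryBeltClass (generic MGHD: complete 𝓘⁺ +
exhaustive charts modelled on stationary
vacuum exteriors, needs definition request D2) → NoBombAttractor (T-trapped zero-energy ray ⇒
growing quasimode ⇒ Christodoulou-exceptional;
shared with zero-energy-optics-kerr-or-bomb) → KerrFromHawkingExtension (smooth Carter–Robinson–CC
for the limits) → FinalStateFromRigidity.
A tensor form of K1 (all belt-supported DRic-solutions with 𝓛_T w = 0 are 𝓛_X g, X
Killing-near-each-end) waits for definition request D1.

KILL CRITERIA. A smooth vacuum stationary AF black hole (or a local belt model: a smooth stationary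
Ricci-flat metric equal to Kerr outside a T-compact
subset of the open ergoregion at positive distance from the horizon, not isometric to Kerr there)
refutes BeltKillingLiouville and the
target at once — close `refuted:BeltKillingLiouville` and hand the witness to the negatives index
(it would also settle the AIK conjecture
negatively). A refutation of BeltReduction alone (e.g. a hole whose T-timelike region has a pole
component not reaching infinity) forces a
pivot: restate X with that topological hypothesis explicit. FinalStateFromRigidity refuted (generic
end states outside the belt class, e.g.
stably trapped zero-energy rays surviving as attractors) kills the docking, not the rigidity
theorem: re-dock to whichever class the
dynamics deliver. Smooth rigidity proved elsewhere (analyticity inherited, card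
analytic-inheritance-rigidity-exit) moots K1/K3 but not the frame. A witness that exploits only the
laxity of the hypothesis structure (StationaryAFBlackHole encodes no censorship,
no I⁺-regularity, no horizon topology) — like the flat holonomy loop ℝ × X_α that refuted K1 as
first typed — is answered by making the missing
regularity clause explicit (restate; here π₁(doc) = 0), not by closing the line.

NOT DECOMPOSED YET. The escape-function/positive-commutator split of K1 and its constants (loss at
hyperbolically trapped zero-energy rays is allowed and not
quantified); the spin-2 Kerr model (quantitative Wald theorem, Teukolsky ω = 0 flux monotonicity
(Δ^(s+1) Im R̄R′)′ = −2sam(r−M)Δ^(s−1)|R|²)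
— needs DRic (D1); the static/non-rotating branch (K = T: X is then empty of content and
Israel–Bunting–Masood lives in the frame); the
anti-vacuity lemma 'Kerr on the Kerr-star chart satisfies every hypothesis of X' (needs D3);
everything dynamical inside the frame.

CHEAPEST FALSIFIER. (i) Run by hand this session, and it CHANGED the statements: on Kerr take a
T-invariant shell B = {r₁ ≤ r ≤ r₂} ⊂ doc and Z = ∂_φ for r > r₂,
Z = c∂_φ + d∂_t for r < r₁, interpolated with t-independent radial cutoffs; Z commutes with T and is
Killing off B, w = 𝓛_Z g is a compactly
supported stationary linearised vacuum solution, yet no compactly supported X has 𝓛_X g = w unless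
(c,d) = (1,0): 'compact support ⇒
compactly supported pure gauge' (the card's literal K2) is FALSE; K1 therefore asks agreement with a
global Killing field only beyond radius R'
(here Z' = ∂_φ). Refuters: check that no other two-ended gauge phenomenon survives the 'near
infinity only' conclusion. (ii) Zero-energy non-trapping of Kerr (R′(r) = −2(r−M)(L²+Q) < 0 on r >
M) — done, consistent with arXiv:1501.01587 §4.
(iii) The sign audit of the P1 identity at λ = 0 and s·a·m ≠ 0 (card) and ρ²g^(φ̃φ̃) = 1/sin²θ in
ingoing coordinates (card numerics, 1e−14).
(iv) Lookup: near Kerr K1 should follow from T-conditional Carleman theory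
(AlexakisIonescuKlainerman2009) — perturbative regime, not a refutation.
(v) 2026-08-15 retriage + repair: the flat static disclination loop ℝ × X_α (ℝ³ cut along a disc,
reglued by the rotation ρ_α about the disc axis, rim
deleted; Euclidean outside a ball, π₁ = ℤ, holonomy ρ_α) is a legal StationaryAFBlackHole (no
horizon and no completeness are asked) on which
Z = χ(r)∂_y is T-invariant and Killing off a shell while ∂_y has no global Killing extension — it
killed K1 AS FIRST TYPED; the repair adds
`SimplyConnectedSpace 𝓑.doc` (ChruscielWald1994Topology Thm 2.3: the d.o.c. of a stationary AF
globally hyperbolic NEC spacetime is simply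
connected; Kerr: doc ≅ ℝ × (ℝ³ ∖ B̄)) to X, K1, K3. Refuters next: a SIMPLY CONNECTED incomplete or
irregular junk 𝓑 defeating K1 (flat ones cannot:
holonomy factors through π₁ and Nomizu extends every Killing germ on a simply connected analytic
manifold).

NUMBERS. Kerr: r± = M ± √(M²−a²); κ = (r₊−r₋)/(2(r₊²+a²)) ≠ 0 iff |a| < M; Ω_H = a/(2Mr₊);
ergosurface r = M + √(M²−a²cos²θ), touching the horizon
exactly at the poles; E = 0 null geodesics: R(r) = a²L_z² − Δ(L_z²+Q), Θ = Q − L_z²cot²θ, R strictly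
decreasing on r > M (no T-trapping, all
|a| < M); {g(T,T) ≥ 0} ∩ {g(K,K) ≥ 0} ∩ {r > r₊} = ∅ iff a/M < √(2√2−2) ≈ 0.910 (card numerics:
below it the belt sits where the Hawking field is
timelike); red-shift monodromy of one azimuthal circuit e^(−2πκ/Ω_H) ≠ 1. Items at open: 7 (1
target, 3 cruxes, 2 support, 1 assembly); 2026-08-15 repair restates #0, #2, #3 (same decl names)
and trims the imports to
Stationary, KerrData, Geodesic, Einstein (BlackHoles.lean dropped: no item uses it and it carried
four unproved Kerr-wave / trapped-surface facts into the cone).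

DEFINITION REQUESTS. D1 `LorentzianMetric.linearizedRicci` (DRic_g on smooth symmetric 2-tensor
fields) and `lieDerivBilin` (𝓛_X of a (0,2)-tensor) in
Literature/Geometry/Lorentzian — to state the tensor Belt Liouville theorem, its dual
(dense-range/solvability) face and the spin-2 Kerr model.
D2 `StationaryFinalStateDecomposition` (FinalStateDecomposition with the boosted-Kerr backgrounds
replaced by arbitrary stationary AF vacuum
black-hole exteriors) in Literature/Geometry/Lorentzian — to split FinalStateFromRigidity into
settling + rigidity.
D3 `Kerr.stationaryAFBlackHole` (the Kerr-star / ingoing Kerr–Schild chart {r > r₊ − δ} with slice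
{t* = 0} and its AF end, packaged as a
`StationaryAFBlackHole`) — for the anti-vacuity lemma that Kerr meets every hypothesis of
SmoothHawkingRigidity, and for every other no-hair route.
No cite facts requested: the collar (arXiv:1903.09135 Thm 1.17) enters X as a HYPOTHESIS, to be
discharged inside the frame.

Novelty: Searches (2026-08-15, this seat): `lit read arxiv:1903.09135 --grep` (Thm 1.17, Ex. 1.11 confirmed),
`lit read arxiv:1501.01587 --grep ergo|timelike`
(§3.7 p.12, §4 p.13: the AIK conjecture and 'Kerr has no trapped null geodesics perpendicular to
T'), `lit read arxiv:1608.02035 --pages 1-4`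
(Thm 1.1: ergoregion ∩ 𝓗⁺ = ∅ required); `lit galaxy search --star all`: "black hole uniqueness"
(16: Heusler CUP book panama:423698523750445,
Mars gr-qc/0004018, Hollands–Yazadjiev 0812.3036 …), "trapped null geodesics perpendicular to the
stationary Killing" (0), "rigidity of
stationary black holes" (0), "extension of Killing vector fields" (0); `lit search` ×3 → searchd rc
75 (unavailable 14:50–15:30);
`lean search StationaryAFBlackHole|trapped null geodesic` (no AIK-conjecture fact, no Kerr instance
of the structure); `ledger negatives` (0);
`ledger idea list` (101 cards, none routed). Plus the card's own searches of 2026-08-15 (zbMATH ×9,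
crossref ×2, 42-card scan).
Nearest prior art found: arXiv:1501.01587 §4 (the AIK conjecture: same hypothesis class, envisaged
via unique continuation) and §3.7 (one end
of the belt is free); arXiv:0904.0982 = AlexakisIonescuKlainerman2009 (perturbative rigidity by
T-conditional Carleman sweeps);
arXiv:1903.09135 Thm 1.17 / arXiv:0902.1173 (the collar); arXiv:1608.02035 (vector-field Carleman
estimate outside the ergoregion; Friedman
instability when 𝓗⁺ ∩ ergoregion = ∅); Heusler–Straumann CQG 9 (1992) (virial no-hair for static
matter); Hawking–Hart  [refs: 1903.09135, 1501.01587, 1608.02035, 0904.0982, 0902.1173, arxiv:1903.09135, arxiv:1501.01587, arxiv:1608.02035, AlexakisIonescuKlainerman2009]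

Barriers (technique_class: liouville-compact-support, positive-commutator): - technique_class: liouville-compact-support, positive-commutator
- Literature.Barriers.FinalStateConjecture.IonescuKlainermanNonExtension: evaded by construction —
IK's hair is supported up to the horizon and comes from a characteristic/sideways problem; X assumes
the collar (the printed evasion, arXiv:1903.09135) and K1 quantifies only over defects that are
T-compact inside doc, continuing nothing across any hypersurface; the bet is that LOCAL
non-uniqueness never closes up into a belt-compact exact solution.
- Literature.Barriers.FinalStateConjecture.KerrSuperradiance: used, not fought — at ω = 0
superradiance degenerates into the sign-definite torque flux (source ∝ s·a·m) and the ergoregion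
enters P1's identity only as an azimuthal total derivative; KerrNoTimelikeKillingCombination is why
the multiplier is null-radial (f(r)L), not a Killing energy.
- Literature.Barriers.FinalStateConjecture.SbierskiTrappingObstruction: harmless — a Liouville
theorem for EXACT solutions needs no loss-free estimate; hyperbolic zero-energy trapping costs a
logarithm, and X excludes T-trapped zero-energy rays outright.
- Literature.Barriers.FinalStateConjecture.AretakisInstability: consistent — the collar needs κ ≠ 0
(arXiv:1903.09135 Ex. 1.11), matching the sub-extremal conclusion of the summit; degenerate limits
are the frame's problem (third law / transversality cards).
- Literature.Barriers.FinalStateConjecture.HairyKerrBifurcation: consistent —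
Chodosh–Shlapentokh-Rothman hair needs a ma

History (route lifecycle, newest last):
- 2026-08-15T16:15:29Z · rev 2: restated SmoothHawkingRigidity (stmt-FinalStateConjecture-10011), BeltKillingLiouville (stmt-FinalStateConjecture-10012), BeltReduction (stmt-FinalStateConjecture-10013) — route-repair (cone, g2) by planner-rrepair-…-g2-0: (a) imports trimmed to Stationary/KerrData/Geodesic/Einstein — `Literature.Geometry.Lorent (planner-rrepair-FinalStateConjecture-BeltLiouv-cada204f-g2-0)
- 2026-08-16T04:01:16Z · AUTO-CRUX (backfill): SmoothHawkingRigidity — hypotheses of the deciding theorem that nothing in the route derives are cruxes (operator:999:1085951)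
- 2026-08-20T20:56:47Z · DORMANT — reconciler: no traction for 5 d (last activity statement-checked at 2026-08-15T20:39:20Z); parked, not closed — `ledger route dormant route-FinalStateConjecture (operator:999:3189182)

sub-problem: FinalStateConjecture · status: dormant · opened planner-plancard-FinalStateConjecture-FinalSt-34957966-0 2026-08-15T15:00:56Z · rev 3 · ledger route-FinalStateConjecture-BeltLiouville
GENERATED by the gate from the ledger (D-0016/17). Provers cite these decls: `theorem foo : Summit.FinalStateConjecture.FinalStateConjecture.Theses.BeltLiouville.<Decl> := …` in Summits/FinalStateConjecture/FinalStateConjecture/Theorems/<Name>.lean.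
-/

namespace Summit.FinalStateConjecture.FinalStateConjecture.Theses.BeltLiouville

open scoped BigOperators Topology Manifold Classical MeasureTheory ProbabilityTheory Matrix InnerProductSpace ComplexConjugate ContinuousMap ContDiff
open Filter Set Function TopologicalSpace MeasureTheory

attribute [summit_statement] _root_.FinalStateConjecture

open Literature.Geometry.Lorentzian

-- earlier SmoothHawkingRigidity (stmt-FinalStateConjecture-10011, replaced 2026-08-15T16:15:29Z -> stmt-FinalStateConjecture-10441): retired by None — ∀ (𝓑 : StationaryAFBlackHole.{0}) [𝓑.metric.HasLeviCivita], 𝓑.metric.toPseudoRiemannianMetric.IsRicciFlat → ∀ (U : Set 𝓑.carrier) (K : Π x : 𝓑.carrier, TangentSpace (𝓡 4) x) (κ : ℝ), IsOpen U → 𝓑.horizon ⊆ U → IsConnected 𝓑.horizon → ContMDiffOn (𝓡 4)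
/-- item stmt-FinalStateConjecture-10441 · crux (kind.auto-crux: conjecture-grade) · rank 0 · open · by planner
why it might fail: Hawking step of the AIK conjecture (1501.01587 §4), open beyond near-Kerr (0904.0982); IK local hair (1108.3575 Thm 1.3): the equations alone cannot force K to extend; StationaryAFBlackHole still omits I⁺-regularity (doc globally hyperbolic, S² sections) — only π₁(doc)=0 is now assumed.
sources: arXiv:1501.01587, AlexakisIonescuKlainerman2009, AlexakisIonescuKlainerman2014, IonescuKlainerman2012, arXiv:1903.09135, ChruscielCostaHeusler2012
[target] X as in § Thesis, REPAIRED 2026-08-15 (+ topological-censorship clause): vacuum 𝓑 :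
StationaryAFBlackHole with SIMPLY CONNECTED d.o.c. (`SimplyConnectedSpace 𝓑.doc`;
ChruscielWald1994Topology Thm 2.3 gives it for every stationary AF globally hyperbolic NEC d.o.c.,
Kerr has doc ≅ ℝ × (ℝ³ ∖ B̄); the frame FinalStateFromRigidity must supply it for the limits), U
open ⊇ horizon (connected), K smooth and Killing on U, [T,K] = 0 on U, K ≠ 0 and tangent on the
horizon, ∇_K K = κK with κ ≠ 0, d.o.c. covered by U₁ ⋐ U, the T-orbit of a compact S ⊆ doc and the
T-orbit of the region beyond radius R' (orbit S disjoint from the region beyond R'+1), and no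
maximal null geodesic with g(γ',T) = 0 contained in the T-orbit of a compact subset of doc ⟹ ∃ K'
smooth and Killing on doc, [T,K'] = 0 on doc, K' = K on U' ∩ doc for some open U' ⊇ horizon. -/
@[route_item "route-FinalStateConjecture-BeltLiouville", crux]
def SmoothHawkingRigidity : Prop :=
  ∀ (𝓑 : StationaryAFBlackHole.{0}) [𝓑.metric.HasLeviCivita], 𝓑.metric.toPseudoRiemannianMetric.IsRicciFlat → SimplyConnectedSpace 𝓑.doc → ∀ (U : Set 𝓑.carrier) (K : Π x : 𝓑.carrier, TangentSpace (𝓡 4) x) (κ : ℝ), IsOpen U → 𝓑.horizon ⊆ U → IsConnected 𝓑.horizon → ContMDiffOn (𝓡 4) ((𝓡 4).prod 𝓘(ℝ, E4)) ∞ (fun x ↦ (Bundle.TotalSpace.mk' E4 x (K x) : TangentBundle (𝓡 4) 𝓑.carrier)) U → (∀ x ∈ U, ∀ v w : TangentSpace (𝓡 4) x, 𝓑.metric.val x (𝓑.metric.leviCivita K x v) w + 𝓑.metric.val x v (𝓑.metric.leviCivita K x w) = 0) → (∀ x ∈ U, VectorField.mlieBracket (𝓡 4) 𝓑.killing K x =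 0) → (∀ p ∈ 𝓑.horizon, K p ≠ 0) → (∀ γ : ℝ → 𝓑.carrier, IsMIntegralCurve γ K → γ 0 ∈ 𝓑.horizon → ∀ t, γ t ∈ 𝓑.horizon) → κ ≠ 0 → (∀ p ∈ 𝓑.horizon, 𝓑.metric.leviCivita K p (K p) = κ • K p) → (∃ (U₁ : Set 𝓑.carrier) (R' : ℝ) (S : Set 𝓑.carrier), IsOpen U₁ ∧ 𝓑.horizon ⊆ U₁ ∧ closure U₁ ⊆ U ∧ 𝓑.e.R + 1 ≤ R' ∧ IsCompact S ∧ S ⊆ 𝓑.doc ∧ Disjoint (stationaryOrbit 𝓑.killing S) (stationaryOrbit 𝓑.killing (𝓑.embed '' 𝓑.e.far (R' + 1))) ∧ ∀ x ∈ 𝓑.doc, x ∉ U₁ → x ∉ (stationaryOrbit 𝓑.killing (𝓑.embed '' 𝓑.e.far R')) → x ∈ stationaryOrbit 𝓑.killing S) → (∀ S : Set 𝓑.carrier, IsCompact S → S ⊆ 𝓑.doc → (∀ (γ : ℝ → 𝓑.carrier) (s : Set ℝ), IsMaximalGeodesicOn 𝓑.metric.toPseudoRiemannianMetric.leviCivita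 γ s → s.Nonempty → (∀ t ∈ s, 𝓑.metric.val (γ t) (velocity (𝓡 4) γ t) (velocity (𝓡 4) γ t) = 0 ∧ velocity (𝓡 4) γ t ≠ 0 ∧ 𝓑.metric.val (γ t) (velocity (𝓡 4) γ t) (𝓑.killing (γ t)) = 0) → ∃ t ∈ s, γ t ∉ stationaryOrbit 𝓑.killing S)) → ∃ K' : Π x : 𝓑.carrier, TangentSpace (𝓡 4) x, ContMDiffOn (𝓡 4) ((𝓡 4).prod 𝓘(ℝ, E4)) ∞ (fun x ↦ (Bundle.TotalSpace.mk' E4 x (K' x) : TangentBundle (𝓡 4) 𝓑.carrier)) 𝓑.doc ∧ (∀ x ∈ 𝓑.doc, ∀ v w : TangentSpace (𝓡 4) x, 𝓑.metric.val x (𝓑.metric.leviCivita K' x v) w + 𝓑.metric.val x v (𝓑.metric.leviCivita K' x w) = 0) ∧ (∀ x ∈ 𝓑.doc, VectorField.mlieBracket (𝓡 4) 𝓑.killing K' x = 0) ∧ ∃ U' : Set 𝓑.carrier, IsOpen U' ∧ 𝓑.horizon ⊆ U' ∧ ∀ x ∈ U' ∩ 𝓑.doc, K' x = K x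

-- earlier BeltKillingLiouville (stmt-FinalStateConjecture-10012, replaced 2026-08-15T16:15:29Z -> stmt-FinalStateConjecture-10442): retired by None — ∀ (𝓑 : StationaryAFBlackHole.{0}) [𝓑.metric.HasLeviCivita], 𝓑.metric.toPseudoRiemannianMetric.IsRicciFlat → ∀ (S : Set 𝓑.carrier) (R' : ℝ), IsCompact S → S ⊆ 𝓑.doc → 𝓑.e.R + 1 ≤ R' → Disjoint (stationaryOrbit 𝓑.killing S) (stationaryOrbit 𝓑.killing (𝓑.
/-- item stmt-FinalStateConjecture-10442 · crux · rank 2 · open · by planner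
why it might fail: π₁(doc)=0 kills the flat holonomy witness, not genuine smooth belt hair: the IK transport half (π = 𝓛_Z g) has no Morawetz positivity, zero-frequency tensorial multipliers may not be coercive far from Kerr, and IK local non-extension (1108.3575 Thm 1.3) might globalise to belt-compact hair.
sources: IonescuKlainerman2012, arXiv:1501.01587, arXiv:1608.02035, AlexakisIonescuKlainerman2009, ChruscielWald1994Topology, Nomizu1960
[crux] [card K1, vector-field form; REPAIRED 2026-08-15: + π₁(doc) = 0] For a vacuum 𝓑 with simply
connected d.o.c., a compact S ⊆ doc and R' ≥ e.R+1 with orbit_T(S) disjoint from orbit_T(embed(far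
R')), such that no maximal zero-energy (g(γ',T)=0) null geodesic lies inside orbit_T(S): every Z
smooth on doc with [T,Z] = 0 on doc and Killing on doc ∖ orbit_T(S) admits Z' smooth and Killing on
doc with Z' = Z on orbit_T(embed(far R')) (agreement asked ONLY near infinity; off the belt it is
false already on Kerr). The simple-connectivity clause removes the flat static holonomy witness ℝ ×
X_α recorded by the retriage pass (ℝ³ cut along a disc and reglued by a rotation about the disc
axis, rim deleted: Z = χ(r)∂_y is T-invariant and Killing off a shell, yet ∂_y has monodromy ρ_α
around the rim, so no global Killing Z' exists; legal because the structure asks no horizon,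
completeness or censorship). On analytic simply connected d.o.c.s the item is Nomizu's theorem; its
content is the smooth non-analytic ergo-belt — Ionescu–Klainerman extension across the belt without
pseudo-convexity, traded for zero-energy non-trapping. [difficulty: XL] -/
@[route_item "route-FinalStateConjecture-BeltLiouville", crux]
def BeltKillingLiouville : Prop :=
  ∀ (𝓑 : StationaryAFBlackHole.{0}) [𝓑.metric.HasLeviCivita], 𝓑.metric.toPseudoRiemannianMetric.IsRicciFlat → SimplyConnectedSpace 𝓑.doc → ∀ (S : Set 𝓑.carrier) (R' : ℝ), IsCompact S → S ⊆ 𝓑.doc → 𝓑.e.R + 1 ≤ R' → Disjoint (stationaryOrbit 𝓑.killing S) (stationaryOrbit 𝓑.killing (𝓑.embed '' 𝓑.e.far R')) → (∀ (γ : ℝ → 𝓑.carrier) (s : Set ℝ), IsMaximalGeodesicOn 𝓑.metric.toPseudoRiemannianMetric.leviCivita γ s → s.Nonempty → (∀ t ∈ s, 𝓑.metric.val (γ t) (velocity (𝓡 4) γ t) (velocity (𝓡 4) γ t) = 0 ∧ velocity (𝓡 4) γ t ≠ 0 ∧ 𝓑.metric.val (γ t) (velocity (𝓡 4) γ t) (𝓑.killing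 (γ t)) = 0) → ∃ t ∈ s, γ t ∉ stationaryOrbit 𝓑.killing S) → ∀ Z : Π x : 𝓑.carrier, TangentSpace (𝓡 4) x, ContMDiffOn (𝓡 4) ((𝓡 4).prod 𝓘(ℝ, E4)) ∞ (fun x ↦ (Bundle.TotalSpace.mk' E4 x (Z x) : TangentBundle (𝓡 4) 𝓑.carrier)) 𝓑.doc → (∀ x ∈ 𝓑.doc, VectorField.mlieBracket (𝓡 4) 𝓑.killing Z x = 0) → (∀ x ∈ 𝓑.doc, x ∉ stationaryOrbit 𝓑.killing S → ∀ v w : TangentSpace (𝓡 4) x, 𝓑.metric.val x (𝓑.metric.leviCivita Z x v) w + 𝓑.metric.val x v (𝓑.metric.leviCivita Z x w) = 0) → ∃ Z' : Π x : 𝓑.carrier, TangentSpace (𝓡 4) x, ContMDiffOn (𝓡 4) ((𝓡 4).prod 𝓘(ℝ, E4)) ∞ (fun x ↦ (Bundle.TotalSpace.mk' E4 x (Z' x) : TangentBundle (𝓡 4) 𝓑.carrier)) 𝓑.doc ∧ (∀ x ∈ 𝓑.doc, ∀ v w : TangentSpace (𝓡 4) x, 𝓑.metric.val x (𝓑.metric.leviCivita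 Z' x v) w + 𝓑.metric.val x v (𝓑.metric.leviCivita Z' x w) = 0) ∧ ∀ x ∈ (stationaryOrbit 𝓑.killing (𝓑.embed '' 𝓑.e.far R')), Z' x = Z x

-- earlier BeltReduction (stmt-FinalStateConjecture-10013, replaced 2026-08-15T16:15:29Z -> stmt-FinalStateConjecture-10443): retired by None — ∀ (𝓑 : StationaryAFBlackHole.{0}) [𝓑.metric.HasLeviCivita], 𝓑.metric.toPseudoRiemannianMetric.IsRicciFlat → ∀ (U : Set 𝓑.carrier) (K : Π x : 𝓑.carrier, TangentSpace (𝓡 4) x) (κ : ℝ), IsOpen U → 𝓑.horizon ⊆ U → IsConnected 𝓑.horizon → ContMDiffOn (𝓡 4) ((𝓡 4).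
/-- item stmt-FinalStateConjecture-10443 · crux · rank 3 · open · by planner
why it might fail: Needs S² horizon sections (poles), the collar to MEET A={T timelike}, A's pole component to reach M_ext and be simply connected for Nomizu (π₁(doc)=0 does not control it), Müller-zum-Hagen analyticity in A, a cutoff margin; StationaryAFBlackHole gives no horizon topology or global hyperbolicity.
sources: arXiv:0902.1173, arXiv:1903.09135, ChruscielCosta2008, ChruscielCostaHeusler2012, Nomizu1960, ChruscielWald1994Topology
[crux] [card K3, per hole; REPAIRED 2026-08-15: π₁(doc) = 0 among the hypotheses of X] Under the
hypotheses of SmoothHawkingRigidity for (𝓑, U, K, κ) — now including `SimplyConnectedSpace 𝓑.doc` —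
the belt Liouville property of THIS hole (verbatim the body of BeltKillingLiouville at 𝓑, its vacuum
and simple-connectivity hypotheses discharged by those of X) implies the conclusion of
SmoothHawkingRigidity. Intended proof unchanged: poles exist (hairy ball on S² sections, T ∥ K
there) and the collar meets A = {T timelike} near them; A is analytic (Müller zum Hagen) so K
continues (Nomizu) through the pole component of A out to M_ext; the complement in doc of (U₁ ∪ that
component) is a T-compact belt by the doc-compactness hypothesis; a T-invariant cutoff gives Z, and
the belt Liouville property plus unique continuation of Killing fields on the connected set (U ∩
doc) ∪ A returns K' = K near the horizon. [deps: BeltKillingLiouville] [difficulty: L] -/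
@[route_item "route-FinalStateConjecture-BeltLiouville", crux]
def BeltReduction : Prop :=
  ∀ (𝓑 : StationaryAFBlackHole.{0}) [𝓑.metric.HasLeviCivita], 𝓑.metric.toPseudoRiemannianMetric.IsRicciFlat → SimplyConnectedSpace 𝓑.doc → ∀ (U : Set 𝓑.carrier) (K : Π x : 𝓑.carrier, TangentSpace (𝓡 4) x) (κ : ℝ), IsOpen U → 𝓑.horizon ⊆ U → IsConnected 𝓑.horizon → ContMDiffOn (𝓡 4) ((𝓡 4).prod 𝓘(ℝ, E4)) ∞ (fun x ↦ (Bundle.TotalSpace.mk' E4 x (K x) : TangentBundle (𝓡 4) 𝓑.carrier)) U → (∀ x ∈ U, ∀ v w : TangentSpace (𝓡 4) x, 𝓑.metric.val x (𝓑.metric.leviCivita K x v) w + 𝓑.metric.val x v (𝓑.metric.leviCivita K x w) = 0) → (∀ x ∈ U, VectorField.mlieBracket (𝓡 4) 𝓑.killing K x = 0) → (∀ p ∈ 𝓑.horizon, K p ≠ 0) → (∀ γ : ℝ → 𝓑.carrier, IsMIntegralCurve γ K → γ 0 ∈ 𝓑.horizon → ∀ t, γ t ∈ 𝓑.horizon)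 → κ ≠ 0 → (∀ p ∈ 𝓑.horizon, 𝓑.metric.leviCivita K p (K p) = κ • K p) → (∃ (U₁ : Set 𝓑.carrier) (R' : ℝ) (S : Set 𝓑.carrier), IsOpen U₁ ∧ 𝓑.horizon ⊆ U₁ ∧ closure U₁ ⊆ U ∧ 𝓑.e.R + 1 ≤ R' ∧ IsCompact S ∧ S ⊆ 𝓑.doc ∧ Disjoint (stationaryOrbit 𝓑.killing S) (stationaryOrbit 𝓑.killing (𝓑.embed '' 𝓑.e.far (R' + 1))) ∧ ∀ x ∈ 𝓑.doc, x ∉ U₁ → x ∉ (stationaryOrbit 𝓑.killing (𝓑.embed '' 𝓑.e.far R')) → x ∈ stationaryOrbit 𝓑.killing S) → (∀ S : Set 𝓑.carrier, IsCompact S → S ⊆ 𝓑.doc → (∀ (γ : ℝ → 𝓑.carrier) (s : Set ℝ), IsMaximalGeodesicOn 𝓑.metric.toPseudoRiemannianMetric.leviCivita γ s → s.Nonempty → (∀ t ∈ s, 𝓑.metric.val (γ t) (velocity (𝓡 4) γ t) (velocity (𝓡 4) γ t) = 0 ∧ velocity (𝓡 4) γ t ≠ 0 ∧ 𝓑.metric.val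 (γ t) (velocity (𝓡 4) γ t) (𝓑.killing (γ t)) = 0) → ∃ t ∈ s, γ t ∉ stationaryOrbit 𝓑.killing S)) → (∀ (S : Set 𝓑.carrier) (R' : ℝ), IsCompact S → S ⊆ 𝓑.doc → 𝓑.e.R + 1 ≤ R' → Disjoint (stationaryOrbit 𝓑.killing S) (stationaryOrbit 𝓑.killing (𝓑.embed '' 𝓑.e.far R')) → (∀ (γ : ℝ → 𝓑.carrier) (s : Set ℝ), IsMaximalGeodesicOn 𝓑.metric.toPseudoRiemannianMetric.leviCivita γ s → s.Nonempty → (∀ t ∈ s, 𝓑.metric.val (γ t) (velocity (𝓡 4) γ t) (velocity (𝓡 4) γ t) = 0 ∧ velocity (𝓡 4) γ t ≠ 0 ∧ 𝓑.metric.val (γ t) (velocity (𝓡 4) γ t) (𝓑.killing (γ t)) = 0) → ∃ t ∈ s, γ t ∉ stationaryOrbit 𝓑.killing S) → ∀ Z : Π x : 𝓑.carrier, TangentSpace (𝓡 4) x, ContMDiffOn (𝓡 4) ((𝓡 4).prod 𝓘(ℝ, E4)) ∞ (fun x ↦ (Bundle.TotalSpace.mk' E4 x (Z x) : TangentBundle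 (𝓡 4) 𝓑.carrier)) 𝓑.doc → (∀ x ∈ 𝓑.doc, VectorField.mlieBracket (𝓡 4) 𝓑.killing Z x = 0) → (∀ x ∈ 𝓑.doc, x ∉ stationaryOrbit 𝓑.killing S → ∀ v w : TangentSpace (𝓡 4) x, 𝓑.metric.val x (𝓑.metric.leviCivita Z x v) w + 𝓑.metric.val x v (𝓑.metric.leviCivita Z x w) = 0) → ∃ Z' : Π x : 𝓑.carrier, TangentSpace (𝓡 4) x, ContMDiffOn (𝓡 4) ((𝓡 4).prod 𝓘(ℝ, E4)) ∞ (fun x ↦ (Bundle.TotalSpace.mk' E4 x (Z' x) : TangentBundle (𝓡 4) 𝓑.carrier)) 𝓑.doc ∧ (∀ x ∈ 𝓑.doc, ∀ v w : TangentSpace (𝓡 4) x, 𝓑.metric.val x (𝓑.metric.leviCivita Z' x v) w + 𝓑.metric.val x v (𝓑.metric.leviCivita Z' x w) = 0) ∧ ∀ x ∈ (stationaryOrbit 𝓑.killing (𝓑.embed '' 𝓑.e.far R')), Z' x = Z x) → ∃ K' : Π x : 𝓑.carrier, TangentSpace (𝓡 4) x, ContMDiffOn (𝓡 4) ((𝓡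 4).prod 𝓘(ℝ, E4)) ∞ (fun x ↦ (Bundle.TotalSpace.mk' E4 x (K' x) : TangentBundle (𝓡 4) 𝓑.carrier)) 𝓑.doc ∧ (∀ x ∈ 𝓑.doc, ∀ v w : TangentSpace (𝓡 4) x, 𝓑.metric.val x (𝓑.metric.leviCivita K' x v) w + 𝓑.metric.val x v (𝓑.metric.leviCivita K' x w) = 0) ∧ (∀ x ∈ 𝓑.doc, VectorField.mlieBracket (𝓡 4) 𝓑.killing K' x = 0) ∧ ∃ U' : Set 𝓑.carrier, IsOpen U' ∧ 𝓑.horizon ⊆ U' ∧ ∀ x ∈ U' ∩ 𝓑.doc, K' x = K x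

/-- item stmt-FinalStateConjecture-10014 · crux · rank 4 · open · by planner
why it might fail: The summit's dynamical content: weak cosmic censorship, large-data settling with C²-exhaustive charts, generic sub-extremality (the third law fails: KehleUnger2025), no T-trapped zero-energy rays; only slowly-rotating Kerr stability known (2104.11857); bomb removal (1608.02035 Thm 1.1) needs 𝓔∩𝓗⁺=∅.
sources: DafermosLuk2017, KlainermanSzeftel2023, GiorgiKlainermanSzeftel2022, KehleUnger2025, arXiv:1608.02035, ChruscielCosta2008
[crux] [frame #1: X → Statement] SmoothHawkingRigidity implies the final state conjecture: weak
cosmic censorship + settling of Christodoulou-generic MGHDs to finitely many receding stationary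
vacuum black-hole exteriors in the belt class (non-degenerate Killing collar by arXiv:1903.09135 Thm
1.17, doc compact mod T, zero-energy non-trapping — or else a Friedman/superradiant-bomb instability
makes the limit non-generic) + smooth Carter–Robinson–Chruściel–Costa (axisymmetric ⇒ Kerr) +
sub-extremality and exhaustive charts. This is the docking statement for the stationary-limit cards
(lasalle-bondi-lyapunov-liouville, dissipation-budget-quiet-window-capture,
two-boundary-squeeze-observability-lojasiewicz, zero-energy-optics-kerr-or-bomb K4); it is expected
to be split/superseded by their routes, not attacked head-on here. [deps: SmoothHawkingRigidity]
[difficulty: open-problem] -/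
@[route_item "route-FinalStateConjecture-BeltLiouville", crux]
def FinalStateFromRigidity : Prop :=
  SmoothHawkingRigidity → _root_.FinalStateConjecture

/-- item stmt-FinalStateConjecture-10015 · support · rank 9 · open · by planner
sources: arXiv:0811.0354, Wald1984GR, DafermosRodnianskiShlapentokhrothman2014
[support] [card P1, the model identity] On sub-extremal Kerr (ingoing Kerr–Schild exterior chart) a
smooth solution of □_g ψ = 0 with ∂_{t*}ψ = 0 that vanishes for r ≤ r₊+δ and for r ≥ R vanishes
identically. Proof intended: the card's multiplier identity f ψ_r (Pψ) sinθ = div(…) +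
½(fΔ′−f′Δ)ψ_r² sinθ + ½f′|∇̸ψ|² sinθ with f = Δ^½ (bulk = ¼Δ′Δ^(−½)(Δψ_r² + |∇̸ψ|²) ≥ 0) for P =
∂_rΔ∂_r + 2a∂_r∂_φ̃ + Δ_S², the ergoregion term being the azimuthal total derivative ∂_φ̃(a f ψ_r²
sinθ); alternatively Holmgren–John across the non-characteristic spheres r = const (analytic
coefficients). [difficulty: L] -/
@[route_item "route-FinalStateConjecture-BeltLiouville", crux]
def KerrStationaryScalarLiouville : Prop :=
  ∀ (M a : ℝ) [Kerr.Facts] [Kerr.SliceFacts], Kerr.IsSubextremal M a → ∀ ψ : Kerr.exterior M a → ℝ, ContMDiff 𝓘(ℝ, E4) 𝓘(ℝ, ℝ) ∞ ψ → (∀ x, (Kerr.smoothMetric M a (Kerr.rPlus M a)).toPseudoRiemannianMetric.dalembertian ψ x = 0) → (∀ x, mfderiv 𝓘(ℝ, E4) 𝓘(ℝ, ℝ) ψ x (E4.basisVector 0) = 0) → (∃ δ R : ℝ, 0 < δ ∧ ∀ x : Kerr.exterior M a, (Kerr.radius a (x : E4) ≤ Kerr.rPlus M a + δ ∨ R ≤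 Kerr.radius a (x : E4)) → ψ x = 0) → ∀ x, ψ x = 0

/-- item stmt-FinalStateConjecture-10016 · support · rank 9 · open · by planner
sources: arXiv:1501.01587
[support] [pure logic, PROVED in Sketch.lean as targetOfCruxes_holds] BeltKillingLiouville →
BeltReduction → SmoothHawkingRigidity (by decl name; the decls precede it in the route file): fix
the hole and the collar data, feed BeltReduction the instance of BeltKillingLiouville at that hole.
[difficulty: provable-now] -/
@[route_item "route-FinalStateConjecture-BeltLiouville", crux]
def TargetOfCruxes : Prop :=
  BeltKillingLiouville → BeltReduction → SmoothHawkingRigidity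

/-- item stmt-FinalStateConjecture-10017 · assembly · rank 1 · open · by planner
sources: arXiv:1501.01587, DafermosLuk2017
[assembly] BeltKillingLiouville → BeltReduction → FinalStateFromRigidity → FinalStateConjecture. -/
@[route_item "route-FinalStateConjecture-BeltLiouville", crux]
def Assembly : Prop :=
  BeltKillingLiouville → BeltReduction → FinalStateFromRigidity → _root_.FinalStateConjecture

/-! D-0027 §2.1 — DECIDING THEOREM (planner-authored via `route open/edit --closes-file`; by planner-plancard-FinalStateConjecture-FinalSt-34957966-0 2026-08-15T15:00:57Z):
its hypotheses are this route's items and its conclusion the sub-problem Statement (glue_lint), and it elaborates with this file. -/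

@[closes "route-FinalStateConjecture-BeltLiouville"] theorem closes : SmoothHawkingRigidity → BeltKillingLiouville → BeltReduction → FinalStateFromRigidity → KerrStationaryScalarLiouville → TargetOfCruxes → Assembly → _root_.FinalStateConjecture := fun _h_SmoothHawkingRigidity h_BeltKillingLiouville h_BeltReduction h_FinalStateFromRigidity _h_KerrStationaryScalarLiouville _h_TargetOfCruxes h_Assembly => h_Assembly h_BeltKillingLiouville h_BeltReduction h_FinalStateFromRigidity

end Summit.FinalStateConjecture.FinalStateConjecture.Theses.BeltLiouville
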